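/-
Copyright (c) 2026 the pub-hodgecm-mathlib formalisation cell (harness21).  Typer∕survey seat hodgecm-mathlib-typ-T5b (g0), topic T5 = P8
«(C♯)hol interior», 2026-08-31.  KERNEL module: THEOREMS ONLY (no definition, no named fact, no instance, no notation, no `sorry`).
-/
import Literature.NumberTheory.Automorphic.UnitaryGroupCohomologicalForms
import Literature.NumberTheory.Automorphic.Liu2021.Def411AsPrinted
import HarnessLib

/-!
# A non-zero equivariant map out of an irreducible-or-zero representation is injective ⇒ `HasFinComponent`

Topic `NumberTheory/Automorphic`; namespace `Literature.NumberTheory.Automorphic`.  THEOREMS ONLY.  Cell hodgecm-mathlib FLOOR 0,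
programme P2, topic T5 = P8 «(C♯)hol interior», node B step (4) of the T5-TREE (v4 route §2b): the Schur-type remark closing Liu's
«`π_f|_{G(𝔸_F^∞)} ≃ ρ(θ^∞, ε^∞_χ)`» [Liu2021, Def. 4.11 second bullet; proof of Prop. 4.13 Case 1, l. 2137 «`π^∞_e ≃ …`»] once a
NON-ZERO `U(V)(𝔸_f)`-equivariant map `ρ → P_f` is in hand (node B step (3)) and `ρ` is irreducible-or-zero (★
`Def411WeilCarriers.isIrreducibleOrZero_rhoVAtLine_chiSplittingLine`, [Liu2021, Lem. D.1]).

* `Liu2021.IsIrreducibleOrZero.injective_of_apply_ne_zero` — `ρ` irreducible-or-zero (★ `Liu2021.IsIrreducibleOrZero`), `f : ρ → σ`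
  equivariant (Mathlib `Representation.IntertwiningMap`) with `f v ≠ 0` for some `v` ⇒ `f` injective (its kernel is a
  subrepresentation ≠ ⊤, hence `⊥`);
* `DiscreteAutomorphicRep.hasFinComponent_of_isIrreducibleOrZero` — for a discrete automorphic `P` of `U(J)`: a non-zero
  `U(J)(𝔸_{F,f})`-intertwiner `σ → P.finRep` from an irreducible-or-zero `σ` gives ★ `P.HasFinComponent σ`.

HONEST SCOPE: pure representation theory (Schur); HC_CM is proved only modulo the printed citations until rung 0 closes; this file books
nothing and discharges nothing booked.

## References
* [Liu2021] Y. Liu, Camb. J. Math. 9 (2021), Def. 4.11 (l. 2090–2096); proof of Prop. 4.13 Case 1 (l. 2137); App. D Lemma D.1 (l. 5227).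
* [BorelJacquet1979] A. Borel, H. Jacquet, PSPM 33.1 (1979), §4.6 (`π ≅ π_∞ ⊗ π_f`).
-/

set_option autoImplicit false

noncomputable section

open NumberField MeasureTheory

namespace Literature.NumberTheory.Automorphic

open Literature.NumberTheory.Automorphic.UnitaryGroup

/-! ## §1 Schur: the kernel of an equivariant map out of an irreducible-or-zero representation -/

section Schur

variable {G V W : Type} [Group G] [AddCommGroup V] [Module ℂ V] [AddCommGroup W] [Module ℂ W]
  {ρ : Representation ℂ G V} {σ : Representation ℂ G W}

/-- **A non-zero equivariant map out of an irreducible-or-zero representation is injective**: `ker f` is a subrepresentation of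
`ρ`, so it is `⊥` or `⊤`, and `⊤` is excluded by `f v ≠ 0`. [cite: Liu2021, Def. 4.11 (l. 2090–2096); App. D Lemma D.1 (l. 5227)] -/
theorem Liu2021.IsIrreducibleOrZero.injective_of_apply_ne_zero (hρ : Liu2021.IsIrreducibleOrZero ρ)
    (f : ρ.IntertwiningMap σ) {v : V} (hv : f v ≠ 0) : Function.Injective f := by
  rcases hρ f.ker with h | h
  · intro x y hxy
    have hmem : x - y ∈ f.ker := by
      rw [Representation.IntertwiningMap.mem_ker, map_sub, hxy, sub_self]
    rw [h] at hmem
    exact sub_eq_zero.1 ((Submodule.mem_bot ℂ).1 hmem)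
  · have hmem : v ∈ f.ker := by
      rw [h]
      exact (Submodule.mem_top : v ∈ (⊤ : Subrepresentation ρ).toSubmodule)
    exact absurd ((Representation.IntertwiningMap.mem_ker ρ σ f v).1 hmem) hv

/-- The same with the hypothesis «`f ≠ 0` as a linear map». [cite: Liu2021, Def. 4.11 (l. 2090–2096)] -/
theorem Liu2021.IsIrreducibleOrZero.injective_of_ne_zero (hρ : Liu2021.IsIrreducibleOrZero ρ)
    (f : ρ.IntertwiningMap σ) (hf : (f : V →ₗ[ℂ] W) ≠ 0) : Function.Injective f := by
  obtain ⟨v, hv⟩ : ∃ v, f v ≠ 0 := by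
    by_contra h
    push Not at h
    exact hf (LinearMap.ext h)
  exact hρ.injective_of_apply_ne_zero f hv

end Schur

/-! ## §2 `HasFinComponent` from a non-zero intertwiner -/

section Fin

variable {F E : Type} [Field F] [NumberField F] [Field E] [NumberField E] [Algebra F E] {c : E ≃ₐ[F] E} {N : ℕ}
  {J : Matrix (Fin N) (Fin N) E}
  {μ : Measure (adelicGroupData F E c N J).automorphicQuotient} [(adelicGroupData F E c N J).IsAutomorphicMeasure μ]

/-- **Node B step (4)**: a discrete automorphic `P` of `U(J)` admitting a NON-ZERO `U(J)(𝔸_{F,f})`-intertwiner `f : σ → P.finRep` from an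
irreducible-or-zero `σ` HAS FINITE COMPONENT `σ` (★ `DiscreteAutomorphicRep.HasFinComponent`: an injective intertwiner).
[cite: Liu2021, Def. 4.11 (l. 2090–2096); proof of Prop. 4.13 Case 1 (l. 2137)] [cite: BorelJacquet1979, §4.6] -/
theorem DiscreteAutomorphicRep.hasFinComponent_of_isIrreducibleOrZero (P : DiscreteAutomorphicRep (adelicGroupData F E c N J) μ)
    {W : Type} [AddCommGroup W] [Module ℂ W] {σ : Representation ℂ (UnitaryGroup.finAdelic F E c N J) W}
    (hσ : Liu2021.IsIrreducibleOrZero σ) (f : σ.IntertwiningMap P.finRep) {w : W} (hw : f w ≠ 0) : P.HasFinComponent σ :=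
  ⟨f, hσ.injective_of_apply_ne_zero f hw⟩

/-- The same with «`f ≠ 0` as a linear map». [cite: Liu2021, Def. 4.11 (l. 2090–2096)] [cite: BorelJacquet1979, §4.6] -/
theorem DiscreteAutomorphicRep.hasFinComponent_of_isIrreducibleOrZero_of_ne_zero
    (P : DiscreteAutomorphicRep (adelicGroupData F E c N J) μ)
    {W : Type} [AddCommGroup W] [Module ℂ W] {σ : Representation ℂ (UnitaryGroup.finAdelic F E c N J) W}
    (hσ : Liu2021.IsIrreducibleOrZero σ) (f : σ.IntertwiningMap P.finRep) (hf : (f : W →ₗ[ℂ] P.space.toSubmodule) ≠ 0) :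
    P.HasFinComponent σ :=
  ⟨f, hσ.injective_of_ne_zero f hf⟩

/-- Conversely `HasFinComponent σ` with `σ` on a non-trivial space gives a non-zero intertwiner. [cite: BorelJacquet1979, §4.6] -/
theorem DiscreteAutomorphicRep.HasFinComponent.exists_apply_ne_zero (P : DiscreteAutomorphicRep (adelicGroupData F E c N J) μ)
    {W : Type} [AddCommGroup W] [Module ℂ W] {σ : Representation ℂ (UnitaryGroup.finAdelic F E c N J) W} [Nontrivial W]
    (h : P.HasFinComponent σ) : ∃ (f : σ.IntertwiningMap P.finRep) (w : W), f w ≠ 0 := by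
  obtain ⟨f, hf⟩ := h
  obtain ⟨w, hw⟩ := exists_ne (0 : W)
  exact ⟨f, w, fun h0 => hw (hf (h0.trans (map_zero f).symm))⟩

end Fin

end Literature.NumberTheory.Automorphic

end
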